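import Summits.Ventures.QEDPrecision.Integrands.ResidualRenormalization

/-!
# Residual renormalisation of q-type diagrams: the TREE RULE equals the closed form through order 16
(venture QEDPrecision, cell `pub-qed`, integrand seat int-1, gen 14; companion to
`Integrands/ResidualRenormalization.lean`, gen 13)

HONEST FRAMING (verbatim, venture QEDPrecision): independent recomputation; certified where stated,
statistical where stated; no new-physics claim.

## What this file is

`ResidualRenormalization.lean` typed ONE closed form `coeff n p` for the non-starred coefficients of the AHKN
residual renormalisation formula of the q-type (no lepton loop) diagrams and had the kernel check it against
the four printed formulas (orders 4, 6, 8, 10: arXiv:0712.2607 §VI / App. B, arXiv:1412.8284 eq. (35)). Its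
module docstring records a second, RECURSIVE description — int-1's TREE RULE (VALIDATION.md §V11(b), gen 4)
— as "observed/derived by exact computer algebra through order 14, NOT kernel-checked":

  with one formal variable `x_j` per finite renormalisation constant `ΔLB_{2j}` and `t` tagging the order,
  let `C(t)` be the formal power series fixed by `C = 1 − Σ_{j ≥ 1} x_j t^j C^{2j}`; then the non-starred
  part of `A₁^{(2N)}[q-type]` is `Σ_{n=1}^{N} ΔM_{2n} · [t^{N−n}] C(t)^{2n−1}` (`ΔM₂ := M₂`).

(Reading: every one of the `2n − 1` lepton lines … more precisely every vertex/self-energy insertion slot of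
a magnetic word of order `2n` carries a factor `C`, and an insertion of order `2j` is itself dressed by `C^{2j}`
recursively; the closed form of gen 13 is the Lagrange inversion of this functional equation, whose simplest
column is the Catalan column `coeff_one_replicate`.)

THIS FILE makes the tree rule a computable coefficient extraction `treeCoeff r p = [x^p t^{Σp}] C^r`
(`def treePow`, structural recursion on a fuel argument; integer valued) and has the KERNEL check that the
two descriptions give the SAME coefficient table:

* `treeTable_two … treeTable_five` : tree rule = closed form at orders 4 … 10 — hence, by gen 13's
  `table_two … table_five`, tree rule = PRINT (corollaries `treeTable_eq_printed4 … printed10`);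
* `treeTable_six`, `treeTable_seven`, `treeTable_eight` : tree rule = closed form at orders 12, 14, 16
  (19 + 30 + 45 coefficients; neither side is in print at these orders);
* `treeCoeff_one_replicate_le` : the `M₂ ΔLB₂^k` column of the tree rule is `(−1)^k · Catalan(k)` for
  `k ≤ 9`, by evaluation (the all-`k` statement for the closed form is gen 13's `coeff_one_replicate`).

All by `decide +kernel` (no `native_decide`, no axioms beyond the standard three).

## What is NOT claimed
* The all-order equivalence "tree rule = closed form" (`∀ M, TreeRuleEqClosedFormUpTo M`) is NOT proved here:
  on paper it is ordinary Lagrange inversion; formalising it needs the Lagrange–Bürmann formula / Rothe–Hagen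
  identities, which Mathlib does not have (2026-08). Kernel evidence: `treeRuleEqClosedFormUpTo_eight`, i.e.
  every coefficient of orders 4 … 16 (2 + 4 + 7 + 12 + 19 + 30 + 45 = 119 of them).
* Neither description is DERIVED here from the AHKN subtraction scheme; the link to physics is exactly the
  one certified in gen 13 (agreement with the printed formulas through order 10) — nothing new is asserted
  about orders ≥ 12 beyond "the two int-1 descriptions agree".
* Starred (two-point-vertex) terms: not covered, as in gen 13.
-/

namespace Summit.Ventures.QEDPrecision.Integrands.ResidualRenormalization

/-! ## 1. The tree rule as coefficient extraction -/

/-- the distinct sub-multisets `q ⊆ p` of a partition `p` (weakly decreasing list), as weakly decreasing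
lists (sublists of a sorted list are sorted; duplicates from repeated parts removed). -/
def subParts (p : List ℕ) : List (List ℕ) := p.sublists.dedup

/-- `treePow fuel r p = [x^p t^{Σp}] C(t)^r` for the formal series `C = 1 − Σ_{j ≥ 1} x_j t^j C^{2j}`
(part `j` of `p` = one factor `x_j = ΔLB_{2j}`; the `t`-degree of `x^p` is forced to be `Σ p`).
Recurrences: `[x^p] C^0 = [p = ∅]`; `[x^p] C^{r+1} = Σ_{q ⊆ p} [x^q] C · [x^{p∖q}] C^r`; and, inlined in the
last line, `[x^q] C = 1` if `q = ∅`, else `−Σ_{j ∈ q, distinct} [x^{q∖j}] C^{2j}`. Structural recursion on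
`fuel`; returns the exact coefficient whenever `fuel > r + 3·Σp` (each nested call lowers `r` by one or
trades a part `j` for an exponent `2j`), and `0` where the fuel runs out. -/
def treePow : ℕ → ℕ → List ℕ → ℤ
  | 0, _, _ => 0
  | _ + 1, 0, p => if p = [] then 1 else 0
  | f + 1, r + 1, p =>
      ((subParts p).map fun q =>
        (if q = [] then 1 else -((q.dedup.map fun j => treePow f (2 * j) (q.erase j)).sum))
          * treePow f r (p.diff q)).sum

/-- `treeCoeff r p = [x^p t^{Σp}] C(t)^r`, with adequate fuel `r + 3·Σp + 2`. -/
def treeCoeff (r : ℕ) (p : List ℕ) : ℤ := treePow (r + 3 * p.sum + 2) r p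

/-- THE TREE RULE as a coefficient table of order `2N`, same layout as `table N`: entries
`(n, p, [x^p t^{N−n}] C^{2n−1})` = the coefficient of `ΔM_{2n} · Π_{j ∈ p} ΔLB_{2j}`, for `n = N, …, 1` and
`p` over `partitions (N − n)`. -/
def treeTable (N : ℕ) : List (ℕ × List ℕ × ℚ) :=
  (List.range N).flatMap fun m => (partitions m).map fun p => (N - m, p, (treeCoeff (2 * (N - m) - 1) p : ℚ))

/-- "tree rule = closed form at every order `2N`, `2 ≤ N ≤ M`". The all-order statement `∀ M, TreeRuleEqClosedFormUpTo M`
is the Lagrange inversion of `C = 1 − Σ_j x_j t^j C^{2j}` and is NOT proved in this file; `M = 8` is (`treeRuleEqClosedFormUpTo_eight`). -/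
def TreeRuleEqClosedFormUpTo (M : ℕ) : Prop := ∀ N : ℕ, 2 ≤ N → N ≤ M → treeTable N = table N

/-! ## 2. Kernel checks: tree rule = closed form, orders 4 … 16 -/

/-- order 4 (2 coefficients). -/
theorem treeTable_two : treeTable 2 = table 2 := by decide +kernel
/-- order 6 (4 coefficients). -/
theorem treeTable_three : treeTable 3 = table 3 := by decide +kernel
/-- order 8 (7 coefficients). -/
theorem treeTable_four : treeTable 4 = table 4 := by decide +kernel
/-- order 10 (12 coefficients). -/
theorem treeTable_five : treeTable 5 = table 5 := by decide +kernel
/-- order 12 (19 coefficients). -/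
theorem treeTable_six : treeTable 6 = table 6 := by decide +kernel
/-- order 14 (30 coefficients). -/
theorem treeTable_seven : treeTable 7 = table 7 := by decide +kernel
/-- order 16 (45 coefficients). -/
theorem treeTable_eight : treeTable 8 = table 8 := by decide +kernel

/-- tree rule = closed form at every order 4 … 16 (`2 ≤ N ≤ 8`; 119 coefficients in all). -/
theorem treeRuleEqClosedFormUpTo_eight : TreeRuleEqClosedFormUpTo 8 := by
  intro N h2 h8
  interval_cases N
  · exact treeTable_two
  · exact treeTable_three
  · exact treeTable_four
  · exact treeTable_five
  · exact treeTable_six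
  · exact treeTable_seven
  · exact treeTable_eight

/-! ## 3. Corollaries: tree rule = print (orders 4 … 10), = the order-12 prediction, Catalan column -/

/-- order 4: tree rule = the printed formula `ΔM₄ − M₂ ΔLB₂`. -/
theorem treeTable_eq_printed4 : treeTable 2 = printed4 := treeTable_two.trans table_two
/-- order 6: tree rule = print. -/
theorem treeTable_eq_printed6 : treeTable 3 = printed6 := treeTable_three.trans table_three
/-- order 8: tree rule = print (non-starred part, exponents as corrected, gen 13 docstring). -/
theorem treeTable_eq_printed8 : treeTable 4 = printed8 := treeTable_four.trans table_four
/-- order 10: tree rule = print (non-starred part of arXiv:1412.8284 eq. (35)). -/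
theorem treeTable_eq_printed10 : treeTable 5 = printed10 := treeTable_five.trans table_five
/-- order 12: tree rule = the closed form's prediction `predicted12`. -/
theorem treeTable_eq_predicted12 : treeTable 6 = predicted12 := treeTable_six.trans table_six

/-- the `M₂ ΔLB₂^k` column of the TREE rule is `(−1)^k · Catalan(k)` for `k ≤ 9`
(`[x₁^k] C = (−1)^k C_k`: `C(x₁) = (1 − √(1 + 4x₁t)) / (−2x₁t)` solves `C = 1 − x₁ t C²`). -/
theorem treeCoeff_one_replicate_le (k : ℕ) (hk : k ≤ 9) :
    treeCoeff 1 (List.replicate k 1) = (-1) ^ k * (catalan k : ℤ) := by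
  interval_cases k <;> decide +kernel

end Summit.Ventures.QEDPrecision.Integrands.ResidualRenormalization
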